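import Summits.Ventures.GridStability.Bench.KUNDUR2ACSGDeg4AOwnVDeg4Nu4ibk3m1PpData23
import Summits.Ventures.GridStability.Bench.KUNDUR2ACSGDeg4AOwnVDeg4Nu4ibk3m1PpPsd1
import Summits.Ventures.GridStability.Bench.KUNDUR2ACSGDeg4AOwnVDeg4Nu4ibk3m1PpPsd2
import Summits.Ventures.GridStability.Bench.KUNDUR2ACSGDeg4AOwnVDeg4Nu4ibk3m1PpPsd3
import Summits.Ventures.GridStability.Bench.KUNDUR2ACSGDeg4AOwnVDeg4Nu4ibk3m1PpPsd4
import Summits.Ventures.GridStability.Bench.KUNDUR2ACSGDeg4AOwnVDeg4Nu4ibk3m1PpChk1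
import Summits.Ventures.GridStability.Bench.KUNDUR2ACSGDeg4AOwnVDeg4Nu4ibk3m1PpChk2
import Summits.Ventures.GridStability.Bench.KUNDUR2ACSGDeg4AOwnVDeg4Nu4ibk3m1PpChk3
import Summits.Ventures.GridStability.Bench.KUNDUR2ACSGDeg4AOwnVDeg4Nu4ibk3m1PpChk4
import Summits.Ventures.GridStability.Bench.KUNDUR2ACSGDeg4AOwnVDeg4Nu4ibk3m1PpChk5
import Summits.Ventures.GridStability.Bench.KUNDUR2ACSGDeg4AOwnVDeg4Nu4ibk3m1PpChk6
import Summits.Ventures.GridStability.Bench.KUNDUR2ACSGDeg4AOwnVDeg4Nu4ibk3m1PpChk7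
import Summits.Ventures.GridStability.Bench.KUNDUR2ACSGDeg4AOwnVDeg4Nu4ibk3m1PpTwinPsd
import Mathlib.Tactic.LinearCombination
import Mathlib.Tactic.Positivity
import Literature.Computation.Certificates.GramSOSRows
import Literature.Computation.Certificates.Blocks
import Literature.Computation.Certificates.PosSemidefIntList
import Literature.Computation.Certificates.GramSOSList
import HarnessLib
-- PORT cert/sos-5/emit_lean.py@3c0ddfa08ee45cdb / source cert/A/KUNDUR2A-CSG-deg4-A-ownV-deg4-nu4ibk3m1-pp.json sha256: 36c09ec489f469d09080d3070dd11696da37ce8d26561deee755fc53d4368fd8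
-- estimated kernel time of this file's `decide`s: 78 s (emitter calibration 2026-08-26; RULING 8 budget 100 s per file)

/-!
# Ventures/GridStability — Bench/KUNDUR2ACSGDeg4AOwnVDeg4Nu4ibk3m1PpPart4.lean: PART 4 of 4 of certificate file `KUNDUR2A-CSG-deg4-A-ownV-deg4-nu4ibk3m1-pp` (system KUNDUR2A-CSG, V degree 4, toolchain A)

Kernel checks and certified inequalities for the identities
`deg4_A_ownV_deg4_nu4ibk3m1_pp_arc_excl_kappa_11`, `deg4_A_ownV_deg4_nu4ibk3m1_pp_arc_excl_kappa_12`
of certificate `KUNDUR2A-CSG-deg4-A-ownV-deg4-nu4ibk3m1-pp` (data in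
`Summits.Ventures.GridStability.Bench.KUNDUR2ACSGDeg4AOwnVDeg4Nu4ibk3m1PpData`); the conjunction
`deg4_A_ownV_deg4_nu4ibk3m1_pp_certificate` and the full docstring (three columns, provenance,
identity list) are in `Bench/KUNDUR2ACSGDeg4AOwnVDeg4Nu4ibk3m1Pp.lean`. Split by the emitter so that
each file's `decide +kernel` time stays inside the RULING 8 budget (estimated 78 s here). «algebraic
inequalities certified; ROA inclusion pending Lyapunov/ lemma».
-/

namespace Summit.Ventures.GridStability.Bench.KUNDUR2ACSG

open Literature.Computation.Certificates Literature.Computation.Certificates.SOS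
open Literature.Computation.Certificates.SOS.Poly

/-! ### Kernel checks (`decide +kernel`) — data in `Summits.Ventures.GridStability.Bench.KUNDUR2ACSGDeg4AOwnVDeg4Nu4ibk3m1PpData` -/

/-- ℤ-LIST SYMMETRY CHECK of `deg4_A_ownV_deg4_nu4ibk3m1_pp_arc_excl_kappa_11_free_zA` (`PSD.symCheckZ`, one `decide`). [folklore] -/
theorem deg4_A_ownV_deg4_nu4ibk3m1_pp_arc_excl_kappa_11_free_zsym : PSD.symCheckZ 52 deg4_A_ownV_deg4_nu4ibk3m1_pp_arc_excl_kappa_11_free_zA = true := by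
  decide +kernel

/-- INTEGER ROUNDED GRAM CERTIFICATE of `deg4_A_ownV_deg4_nu4ibk3m1_pp_arc_excl_kappa_11_free`
(`PSD.IsGramCertZ` of `(zA, zd, zBT)`), assembled from the symmetry check and the 8 row blocks
(`PSD.IsGramCertZ.of_listCheck'`, `forall_fin_of_blocks 7`). [folklore] -/
theorem deg4_A_ownV_deg4_nu4ibk3m1_pp_arc_excl_kappa_11_free_zcert :
    PSD.IsGramCertZ (matrixOfRows 52 52 deg4_A_ownV_deg4_nu4ibk3m1_pp_arc_excl_kappa_11_free_zA) (vecOfList 52 deg4_A_ownV_deg4_nu4ibk3m1_pp_arc_excl_kappa_11_free_zd) (matrixOfCols 52 52 deg4_A_ownV_deg4_nu4ibk3m1_pp_arc_excl_kappa_11_free_zBT) :=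
  PSD.IsGramCertZ.of_listCheck' deg4_A_ownV_deg4_nu4ibk3m1_pp_arc_excl_kappa_11_free_zsym
    (forall_fin_of_blocks 7 (by norm_num) (by intro c; fin_cases c; exacts [deg4_A_ownV_deg4_nu4ibk3m1_pp_arc_excl_kappa_11_free_zr0, deg4_A_ownV_deg4_nu4ibk3m1_pp_arc_excl_kappa_11_free_zr1, deg4_A_ownV_deg4_nu4ibk3m1_pp_arc_excl_kappa_11_free_zr2, deg4_A_ownV_deg4_nu4ibk3m1_pp_arc_excl_kappa_11_free_zr3, deg4_A_ownV_deg4_nu4ibk3m1_pp_arc_excl_kappa_11_free_zr4, deg4_A_ownV_deg4_nu4ibk3m1_pp_arc_excl_kappa_11_free_zr5, deg4_A_ownV_deg4_nu4ibk3m1_pp_arc_excl_kappa_11_free_zr6, deg4_A_ownV_deg4_nu4ibk3m1_pp_arc_excl_kappa_11_free_zr7]))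

set_option maxHeartbeats 0 in
/-- FORM-AGNOSTIC PSD FACT of `deg4_A_ownV_deg4_nu4ibk3m1_pp_arc_excl_kappa_11_freeL` (L-lane): the
quadratic form of `Q` is nonnegative — `GramL.quadNonneg_of_gramCertZ` from the integer certificate
`deg4_A_ownV_deg4_nu4ibk3m1_pp_arc_excl_kappa_11_free_zcert`, the scale `c := N` and the
list-computed scale test `GramL.scaleOK` (`A = N·Q` entrywise, one `decide`). [folklore] -/
theorem deg4_A_ownV_deg4_nu4ibk3m1_pp_arc_excl_kappa_11_freeL_quad : deg4_A_ownV_deg4_nu4ibk3m1_pp_arc_excl_kappa_11_freeL.toGramSOS.QuadNonneg ℝ :=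
  deg4_A_ownV_deg4_nu4ibk3m1_pp_arc_excl_kappa_11_freeL.quadNonneg_of_gramCertZ deg4_A_ownV_deg4_nu4ibk3m1_pp_arc_excl_kappa_11_free_zcert (c := (deg4_A_ownV_deg4_nu4ibk3m1_pp_arc_excl_kappa_11_free_zN : ℚ)) (by norm_num [deg4_A_ownV_deg4_nu4ibk3m1_pp_arc_excl_kappa_11_free_zN]) (by decide +kernel)

set_option maxHeartbeats 0 in
/-- KERNEL PSD CHECK `deg4_A_ownV_deg4_nu4ibk3m1_pp_arc_excl_kappa_11_ineq1` (size 1): `d ≥ 0` and `Q − Bᵀ·diag d·B` symmetric diagonally dominant. [folklore] -/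
theorem deg4_A_ownV_deg4_nu4ibk3m1_pp_arc_excl_kappa_11_ineq1_valid : PSD.IsGramCertDD (matrixOfRows 1 1 deg4_A_ownV_deg4_nu4ibk3m1_pp_arc_excl_kappa_11_ineq1_Q) (vecOfList 1 deg4_A_ownV_deg4_nu4ibk3m1_pp_arc_excl_kappa_11_ineq1_d) (matrixOfRows 1 1 deg4_A_ownV_deg4_nu4ibk3m1_pp_arc_excl_kappa_11_ineq1_B) := by
  decide +kernel

/-- Form-agnostic PSD fact of `deg4_A_ownV_deg4_nu4ibk3m1_pp_arc_excl_kappa_11_ineq1L` from the block's rounded rational certificate (`GramSOS.quadNonneg_of_valid` through the `GramL` view). [folklore] -/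
theorem deg4_A_ownV_deg4_nu4ibk3m1_pp_arc_excl_kappa_11_ineq1L_quad : deg4_A_ownV_deg4_nu4ibk3m1_pp_arc_excl_kappa_11_ineq1L.toGramSOS.QuadNonneg ℝ :=
  deg4_A_ownV_deg4_nu4ibk3m1_pp_arc_excl_kappa_11_ineq1L.toGramSOS.quadNonneg_of_valid deg4_A_ownV_deg4_nu4ibk3m1_pp_arc_excl_kappa_11_ineq1_valid

set_option maxHeartbeats 0 in
/-- KERNEL RESIDUAL CHECK `deg4_A_ownV_deg4_nu4ibk3m1_pp_arc_excl_kappa_11` (L-lane, GramSOSList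
`residualL1`: list carriers, one zip pass per Gram row, merge-sort normalisation): `p − (σ₀ + Σ gᵢσᵢ
+ Σ hⱼtⱼ)` is the zero polynomial. [folklore] -/
theorem deg4_A_ownV_deg4_nu4ibk3m1_pp_arc_excl_kappa_11_residualL :
    isZero (residualL1 deg4_A_ownV_deg4_nu4ibk3m1_pp_arc_excl_kappa_11_p deg4_A_ownV_deg4_nu4ibk3m1_pp_arc_excl_kappa_11_gsL deg4_A_ownV_deg4_nu4ibk3m1_pp_arc_excl_kappa_11_hs deg4_A_ownV_deg4_nu4ibk3m1_pp_arc_excl_kappa_11_freeL deg4_A_ownV_deg4_nu4ibk3m1_pp_arc_excl_kappa_11_ineqL deg4_A_ownV_deg4_nu4ibk3m1_pp_arc_excl_kappa_11_eqMult) = true := by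
  decide +kernel

set_option maxHeartbeats 0 in
/-- LINK `deg4_A_ownV_deg4_nu4ibk3m1_pp_arc_excl_kappa_11_g0` (level): `Poly.add (Poly.normMS deg4_A_ownV_deg4_nu4ibk3m1_pp_arc_excl_kappa_11_g0) (Poly.add (Poly.normMS deg4_A_ownV_deg4_nu4ibk3m1_pp_V_poly) (Poly.C ((-3 : ℚ)/28)))` is the zero polynomial (kernel zero test). [folklore] -/
theorem deg4_A_ownV_deg4_nu4ibk3m1_pp_arc_excl_kappa_11_g0_link : isZero (Poly.add (Poly.normMS deg4_A_ownV_deg4_nu4ibk3m1_pp_arc_excl_kappa_11_g0) (Poly.add (Poly.normMS deg4_A_ownV_deg4_nu4ibk3m1_pp_V_poly) (Poly.C ((-3 : ℚ)/28)))) = true := by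
  decide +kernel

/-- ℤ-LIST SYMMETRY CHECK of `deg4_A_ownV_deg4_nu4ibk3m1_pp_arc_excl_kappa_12_free_zA` (`PSD.symCheckZ`, one `decide`). [folklore] -/
theorem deg4_A_ownV_deg4_nu4ibk3m1_pp_arc_excl_kappa_12_free_zsym : PSD.symCheckZ 52 deg4_A_ownV_deg4_nu4ibk3m1_pp_arc_excl_kappa_12_free_zA = true := by
  decide +kernel

/-- INTEGER ROUNDED GRAM CERTIFICATE of `deg4_A_ownV_deg4_nu4ibk3m1_pp_arc_excl_kappa_12_free`
(`PSD.IsGramCertZ` of `(zA, zd, zBT)`), assembled from the symmetry check and the 8 row blocks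
(`PSD.IsGramCertZ.of_listCheck'`, `forall_fin_of_blocks 7`). [folklore] -/
theorem deg4_A_ownV_deg4_nu4ibk3m1_pp_arc_excl_kappa_12_free_zcert :
    PSD.IsGramCertZ (matrixOfRows 52 52 deg4_A_ownV_deg4_nu4ibk3m1_pp_arc_excl_kappa_12_free_zA) (vecOfList 52 deg4_A_ownV_deg4_nu4ibk3m1_pp_arc_excl_kappa_12_free_zd) (matrixOfCols 52 52 deg4_A_ownV_deg4_nu4ibk3m1_pp_arc_excl_kappa_12_free_zBT) :=
  PSD.IsGramCertZ.of_listCheck' deg4_A_ownV_deg4_nu4ibk3m1_pp_arc_excl_kappa_12_free_zsym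
    (forall_fin_of_blocks 7 (by norm_num) (by intro c; fin_cases c; exacts [deg4_A_ownV_deg4_nu4ibk3m1_pp_arc_excl_kappa_12_free_zr0, deg4_A_ownV_deg4_nu4ibk3m1_pp_arc_excl_kappa_12_free_zr1, deg4_A_ownV_deg4_nu4ibk3m1_pp_arc_excl_kappa_12_free_zr2, deg4_A_ownV_deg4_nu4ibk3m1_pp_arc_excl_kappa_12_free_zr3, deg4_A_ownV_deg4_nu4ibk3m1_pp_arc_excl_kappa_12_free_zr4, deg4_A_ownV_deg4_nu4ibk3m1_pp_arc_excl_kappa_12_free_zr5, deg4_A_ownV_deg4_nu4ibk3m1_pp_arc_excl_kappa_12_free_zr6, deg4_A_ownV_deg4_nu4ibk3m1_pp_arc_excl_kappa_12_free_zr7]))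

set_option maxHeartbeats 0 in
/-- FORM-AGNOSTIC PSD FACT of `deg4_A_ownV_deg4_nu4ibk3m1_pp_arc_excl_kappa_12_freeL` (L-lane): the
quadratic form of `Q` is nonnegative — `GramL.quadNonneg_of_gramCertZ` from the integer certificate
`deg4_A_ownV_deg4_nu4ibk3m1_pp_arc_excl_kappa_12_free_zcert`, the scale `c := N` and the
list-computed scale test `GramL.scaleOK` (`A = N·Q` entrywise, one `decide`). [folklore] -/
theorem deg4_A_ownV_deg4_nu4ibk3m1_pp_arc_excl_kappa_12_freeL_quad : deg4_A_ownV_deg4_nu4ibk3m1_pp_arc_excl_kappa_12_freeL.toGramSOS.QuadNonneg ℝ :=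
  deg4_A_ownV_deg4_nu4ibk3m1_pp_arc_excl_kappa_12_freeL.quadNonneg_of_gramCertZ deg4_A_ownV_deg4_nu4ibk3m1_pp_arc_excl_kappa_12_free_zcert (c := (deg4_A_ownV_deg4_nu4ibk3m1_pp_arc_excl_kappa_12_free_zN : ℚ)) (by norm_num [deg4_A_ownV_deg4_nu4ibk3m1_pp_arc_excl_kappa_12_free_zN]) (by decide +kernel)

set_option maxHeartbeats 0 in
/-- KERNEL PSD CHECK `deg4_A_ownV_deg4_nu4ibk3m1_pp_arc_excl_kappa_12_ineq1` (size 1): `d ≥ 0` and `Q − Bᵀ·diag d·B` symmetric diagonally dominant. [folklore] -/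
theorem deg4_A_ownV_deg4_nu4ibk3m1_pp_arc_excl_kappa_12_ineq1_valid : PSD.IsGramCertDD (matrixOfRows 1 1 deg4_A_ownV_deg4_nu4ibk3m1_pp_arc_excl_kappa_12_ineq1_Q) (vecOfList 1 deg4_A_ownV_deg4_nu4ibk3m1_pp_arc_excl_kappa_12_ineq1_d) (matrixOfRows 1 1 deg4_A_ownV_deg4_nu4ibk3m1_pp_arc_excl_kappa_12_ineq1_B) := by
  decide +kernel

/-- Form-agnostic PSD fact of `deg4_A_ownV_deg4_nu4ibk3m1_pp_arc_excl_kappa_12_ineq1L` from the block's rounded rational certificate (`GramSOS.quadNonneg_of_valid` through the `GramL` view). [folklore] -/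
theorem deg4_A_ownV_deg4_nu4ibk3m1_pp_arc_excl_kappa_12_ineq1L_quad : deg4_A_ownV_deg4_nu4ibk3m1_pp_arc_excl_kappa_12_ineq1L.toGramSOS.QuadNonneg ℝ :=
  deg4_A_ownV_deg4_nu4ibk3m1_pp_arc_excl_kappa_12_ineq1L.toGramSOS.quadNonneg_of_valid deg4_A_ownV_deg4_nu4ibk3m1_pp_arc_excl_kappa_12_ineq1_valid

set_option maxHeartbeats 0 in
/-- KERNEL RESIDUAL CHECK `deg4_A_ownV_deg4_nu4ibk3m1_pp_arc_excl_kappa_12` (L-lane, GramSOSList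
`residualL1`: list carriers, one zip pass per Gram row, merge-sort normalisation): `p − (σ₀ + Σ gᵢσᵢ
+ Σ hⱼtⱼ)` is the zero polynomial. [folklore] -/
theorem deg4_A_ownV_deg4_nu4ibk3m1_pp_arc_excl_kappa_12_residualL :
    isZero (residualL1 deg4_A_ownV_deg4_nu4ibk3m1_pp_arc_excl_kappa_12_p deg4_A_ownV_deg4_nu4ibk3m1_pp_arc_excl_kappa_12_gsL deg4_A_ownV_deg4_nu4ibk3m1_pp_arc_excl_kappa_12_hs deg4_A_ownV_deg4_nu4ibk3m1_pp_arc_excl_kappa_12_freeL deg4_A_ownV_deg4_nu4ibk3m1_pp_arc_excl_kappa_12_ineqL deg4_A_ownV_deg4_nu4ibk3m1_pp_arc_excl_kappa_12_eqMult) = true := by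
  decide +kernel

set_option maxHeartbeats 0 in
/-- LINK `deg4_A_ownV_deg4_nu4ibk3m1_pp_arc_excl_kappa_12_g0` (level): `Poly.add (Poly.normMS deg4_A_ownV_deg4_nu4ibk3m1_pp_arc_excl_kappa_12_g0) (Poly.add (Poly.normMS deg4_A_ownV_deg4_nu4ibk3m1_pp_V_poly) (Poly.C ((-3 : ℚ)/28)))` is the zero polynomial (kernel zero test). [folklore] -/
theorem deg4_A_ownV_deg4_nu4ibk3m1_pp_arc_excl_kappa_12_g0_link : isZero (Poly.add (Poly.normMS deg4_A_ownV_deg4_nu4ibk3m1_pp_arc_excl_kappa_12_g0) (Poly.add (Poly.normMS deg4_A_ownV_deg4_nu4ibk3m1_pp_V_poly) (Poly.C ((-3 : ℚ)/28)))) = true := by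
  decide +kernel

/-! ### The certified inequalities (README §3 T3; «algebraic inequalities certified; ROA inclusion pending Lyapunov/ lemma») -/

/-- **`deg4_A_ownV_deg4_nu4ibk3m1_pp_arc_excl_kappa_11`** (CERTIFIED, model `KUNDUR2A-CSG instance
KUNDUR2A-CSG-pre-h12-λ1/10 (model-1 I2 file, f verbatim)`; ALGEBRAIC inequality, ROA inclusion
pending Lyapunov/ lemma): 1 - kappa_11 >= 0 on {level - V >= 0} cap {h = 0} (arc exclusion 1 -
cos(u) <= kappa_max < 2 for this relative angle: director RULING 3 (4) / MODEL-VALIDITY MV-1(e)) —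
for every real point satisfying the listed hypotheses (hV, hh1, hh2, hh3). [folklore] -/
theorem deg4_A_ownV_deg4_nu4ibk3m1_pp_arc_excl_kappa_11 (sigma_2 kappa_2 sigma_11 kappa_11 sigma_12 kappa_12 nu_2 nu_11 nu_12 : ℝ) (hV : deg4_A_ownV_deg4_nu4ibk3m1_pp_V sigma_2 kappa_2 sigma_11 kappa_11 sigma_12 kappa_12 nu_2 nu_11 nu_12 ≤ (3 / 28 : ℝ)) (hh1 : deg4_A_ownV_deg4_nu4ibk3m1_pp_h1 sigma_2 kappa_2 sigma_11 kappa_11 sigma_12 kappa_12 nu_2 nu_11 nu_12 = 0) (hh2 : deg4_A_ownV_deg4_nu4ibk3m1_pp_h2 sigma_2 kappa_2 sigma_11 kappa_11 sigma_12 kappa_12 nu_2 nu_11 nu_12 = 0) (hh3 : deg4_A_ownV_deg4_nu4ibk3m1_pp_h3 sigma_2 kappa_2 sigma_11 kappa_11 sigma_12 kappa_12 nu_2 nu_11 nu_12 = 0) :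
    kappa_11 ≤ (1 : ℝ) := by
  simp only [deg4_A_ownV_deg4_nu4ibk3m1_pp_V] at hV
  simp only [deg4_A_ownV_deg4_nu4ibk3m1_pp_h1, deg4_A_ownV_deg4_nu4ibk3m1_pp_h1_poly, eval_cons, eval_nil, Monomial.eval_eq, Monomial.evalFrom_cons, Monomial.evalFrom_nil,
        vars_cons_zero, vars_cons_succ] at hh1
  push_cast at hh1
  simp only [deg4_A_ownV_deg4_nu4ibk3m1_pp_h2, deg4_A_ownV_deg4_nu4ibk3m1_pp_h2_poly, eval_cons, eval_nil, Monomial.eval_eq, Monomial.evalFrom_cons, Monomial.evalFrom_nil,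
        vars_cons_zero, vars_cons_succ] at hh2
  push_cast at hh2
  simp only [deg4_A_ownV_deg4_nu4ibk3m1_pp_h3, deg4_A_ownV_deg4_nu4ibk3m1_pp_h3_poly, eval_cons, eval_nil, Monomial.eval_eq, Monomial.evalFrom_cons, Monomial.evalFrom_nil,
        vars_cons_zero, vars_cons_succ] at hh3
  push_cast at hh3
  have h := nonneg_of_quadL (p := deg4_A_ownV_deg4_nu4ibk3m1_pp_arc_excl_kappa_11_p) (gs := deg4_A_ownV_deg4_nu4ibk3m1_pp_arc_excl_kappa_11_gsL) (hs := deg4_A_ownV_deg4_nu4ibk3m1_pp_arc_excl_kappa_11_hs) (free := deg4_A_ownV_deg4_nu4ibk3m1_pp_arc_excl_kappa_11_freeL) (ineq := deg4_A_ownV_deg4_nu4ibk3m1_pp_arc_excl_kappa_11_ineqL)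
    (eqMult := deg4_A_ownV_deg4_nu4ibk3m1_pp_arc_excl_kappa_11_eqMult) deg4_A_ownV_deg4_nu4ibk3m1_pp_arc_excl_kappa_11_freeL_quad
    (by
      intro σ hσ
      simp only [deg4_A_ownV_deg4_nu4ibk3m1_pp_arc_excl_kappa_11_ineqL, List.mem_cons, List.not_mem_nil, or_false] at hσ
      rcases hσ with rfl
      · exact deg4_A_ownV_deg4_nu4ibk3m1_pp_arc_excl_kappa_11_ineq1L_quad)
    deg4_A_ownV_deg4_nu4ibk3m1_pp_arc_excl_kappa_11_residualL (vars [sigma_2, kappa_2, sigma_11, kappa_11, sigma_12, kappa_12, nu_2, nu_11, nu_12])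
    (by
      intro g hg
      simp only [deg4_A_ownV_deg4_nu4ibk3m1_pp_arc_excl_kappa_11_gsL, List.mem_cons, List.not_mem_nil, or_false] at hg
      rcases hg with rfl
      · have e := eval_eq_zero_of_isZero (vars [sigma_2, kappa_2, sigma_11, kappa_11, sigma_12, kappa_12, nu_2, nu_11, nu_12]) deg4_A_ownV_deg4_nu4ibk3m1_pp_arc_excl_kappa_11_g0_link
        rw [eval_add, eval_add, eval_C] at e
        simp only [eval_normMS] at e
        push_cast at e
        linarith)
    (by
      intro q hq
      simp only [deg4_A_ownV_deg4_nu4ibk3m1_pp_arc_excl_kappa_11_hs, List.mem_cons, List.not_mem_nil, or_false] at hq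
      rcases hq with rfl | rfl | rfl
      · simp only [eval_cons, eval_nil, Monomial.eval_eq, Monomial.evalFrom_cons, Monomial.evalFrom_nil,
        vars_cons_zero, vars_cons_succ]
        push_cast
        linear_combination hh1
      · simp only [eval_cons, eval_nil, Monomial.eval_eq, Monomial.evalFrom_cons, Monomial.evalFrom_nil,
        vars_cons_zero, vars_cons_succ]
        push_cast
        linear_combination hh2
      · simp only [eval_cons, eval_nil, Monomial.eval_eq, Monomial.evalFrom_cons, Monomial.evalFrom_nil,
        vars_cons_zero, vars_cons_succ]
        push_cast
        linear_combination hh3)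
  simp only [deg4_A_ownV_deg4_nu4ibk3m1_pp_arc_excl_kappa_11_p, eval_cons, eval_nil, Monomial.eval_eq, Monomial.evalFrom_cons, Monomial.evalFrom_nil,
        vars_cons_zero, vars_cons_succ] at h
  push_cast at h
  linear_combination h

/-- **`deg4_A_ownV_deg4_nu4ibk3m1_pp_arc_excl_kappa_12`** (CERTIFIED, model `KUNDUR2A-CSG instance
KUNDUR2A-CSG-pre-h12-λ1/10 (model-1 I2 file, f verbatim)`; ALGEBRAIC inequality, ROA inclusion
pending Lyapunov/ lemma): 1 - kappa_12 >= 0 on {level - V >= 0} cap {h = 0} (arc exclusion 1 -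
cos(u) <= kappa_max < 2 for this relative angle: director RULING 3 (4) / MODEL-VALIDITY MV-1(e)) —
for every real point satisfying the listed hypotheses (hV, hh1, hh2, hh3). [folklore] -/
theorem deg4_A_ownV_deg4_nu4ibk3m1_pp_arc_excl_kappa_12 (sigma_2 kappa_2 sigma_11 kappa_11 sigma_12 kappa_12 nu_2 nu_11 nu_12 : ℝ) (hV : deg4_A_ownV_deg4_nu4ibk3m1_pp_V sigma_2 kappa_2 sigma_11 kappa_11 sigma_12 kappa_12 nu_2 nu_11 nu_12 ≤ (3 / 28 : ℝ)) (hh1 : deg4_A_ownV_deg4_nu4ibk3m1_pp_h1 sigma_2 kappa_2 sigma_11 kappa_11 sigma_12 kappa_12 nu_2 nu_11 nu_12 = 0) (hh2 : deg4_A_ownV_deg4_nu4ibk3m1_pp_h2 sigma_2 kappa_2 sigma_11 kappa_11 sigma_12 kappa_12 nu_2 nu_11 nu_12 = 0) (hh3 : deg4_A_ownV_deg4_nu4ibk3m1_pp_h3 sigma_2 kappa_2 sigma_11 kappa_11 sigma_12 kappa_12 nu_2 nu_11 nu_12 = 0) :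
    kappa_12 ≤ (1 : ℝ) := by
  simp only [deg4_A_ownV_deg4_nu4ibk3m1_pp_V] at hV
  simp only [deg4_A_ownV_deg4_nu4ibk3m1_pp_h1, deg4_A_ownV_deg4_nu4ibk3m1_pp_h1_poly, eval_cons, eval_nil, Monomial.eval_eq, Monomial.evalFrom_cons, Monomial.evalFrom_nil,
        vars_cons_zero, vars_cons_succ] at hh1
  push_cast at hh1
  simp only [deg4_A_ownV_deg4_nu4ibk3m1_pp_h2, deg4_A_ownV_deg4_nu4ibk3m1_pp_h2_poly, eval_cons, eval_nil, Monomial.eval_eq, Monomial.evalFrom_cons, Monomial.evalFrom_nil,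
        vars_cons_zero, vars_cons_succ] at hh2
  push_cast at hh2
  simp only [deg4_A_ownV_deg4_nu4ibk3m1_pp_h3, deg4_A_ownV_deg4_nu4ibk3m1_pp_h3_poly, eval_cons, eval_nil, Monomial.eval_eq, Monomial.evalFrom_cons, Monomial.evalFrom_nil,
        vars_cons_zero, vars_cons_succ] at hh3
  push_cast at hh3
  have h := nonneg_of_quadL (p := deg4_A_ownV_deg4_nu4ibk3m1_pp_arc_excl_kappa_12_p) (gs := deg4_A_ownV_deg4_nu4ibk3m1_pp_arc_excl_kappa_12_gsL) (hs := deg4_A_ownV_deg4_nu4ibk3m1_pp_arc_excl_kappa_12_hs) (free := deg4_A_ownV_deg4_nu4ibk3m1_pp_arc_excl_kappa_12_freeL) (ineq := deg4_A_ownV_deg4_nu4ibk3m1_pp_arc_excl_kappa_12_ineqL)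
    (eqMult := deg4_A_ownV_deg4_nu4ibk3m1_pp_arc_excl_kappa_12_eqMult) deg4_A_ownV_deg4_nu4ibk3m1_pp_arc_excl_kappa_12_freeL_quad
    (by
      intro σ hσ
      simp only [deg4_A_ownV_deg4_nu4ibk3m1_pp_arc_excl_kappa_12_ineqL, List.mem_cons, List.not_mem_nil, or_false] at hσ
      rcases hσ with rfl
      · exact deg4_A_ownV_deg4_nu4ibk3m1_pp_arc_excl_kappa_12_ineq1L_quad)
    deg4_A_ownV_deg4_nu4ibk3m1_pp_arc_excl_kappa_12_residualL (vars [sigma_2, kappa_2, sigma_11, kappa_11, sigma_12, kappa_12, nu_2, nu_11, nu_12])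
    (by
      intro g hg
      simp only [deg4_A_ownV_deg4_nu4ibk3m1_pp_arc_excl_kappa_12_gsL, List.mem_cons, List.not_mem_nil, or_false] at hg
      rcases hg with rfl
      · have e := eval_eq_zero_of_isZero (vars [sigma_2, kappa_2, sigma_11, kappa_11, sigma_12, kappa_12, nu_2, nu_11, nu_12]) deg4_A_ownV_deg4_nu4ibk3m1_pp_arc_excl_kappa_12_g0_link
        rw [eval_add, eval_add, eval_C] at e
        simp only [eval_normMS] at e
        push_cast at e
        linarith)
    (by
      intro q hq
      simp only [deg4_A_ownV_deg4_nu4ibk3m1_pp_arc_excl_kappa_12_hs, List.mem_cons, List.not_mem_nil, or_false] at hq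
      rcases hq with rfl | rfl | rfl
      · simp only [eval_cons, eval_nil, Monomial.eval_eq, Monomial.evalFrom_cons, Monomial.evalFrom_nil,
        vars_cons_zero, vars_cons_succ]
        push_cast
        linear_combination hh1
      · simp only [eval_cons, eval_nil, Monomial.eval_eq, Monomial.evalFrom_cons, Monomial.evalFrom_nil,
        vars_cons_zero, vars_cons_succ]
        push_cast
        linear_combination hh2
      · simp only [eval_cons, eval_nil, Monomial.eval_eq, Monomial.evalFrom_cons, Monomial.evalFrom_nil,
        vars_cons_zero, vars_cons_succ]
        push_cast
        linear_combination hh3)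
  simp only [deg4_A_ownV_deg4_nu4ibk3m1_pp_arc_excl_kappa_12_p, eval_cons, eval_nil, Monomial.eval_eq, Monomial.evalFrom_cons, Monomial.evalFrom_nil,
        vars_cons_zero, vars_cons_succ] at h
  push_cast at h
  linear_combination h

end Summit.Ventures.GridStability.Bench.KUNDUR2ACSG
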